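import Literature.NumberTheory.GaloisRepresentations.AlgebraicHeckeCharacterPurity
import Literature.FieldTheory.AlgClosed.AutomorphismExtension
import HarnessLib

/-!
# Line `Sketch` for the crux `ReciprocityUpToIrreducibility` (item stmt-Langlands-14328), wave N11-G:
# over a number field with a real place every algebraic Hecke character has parallel infinity type

Support file (closes nothing; stub `stub_infinityType_parallel_of_isReal` of the registered
skeleton of line `Sketch`, continuation lead c9).

Let `K` be a number field with at least one real place `w₀` and `χ` an idelic Hecke character of
`K` (tree `HeckeCharacter`) of infinity type `(p, q)` (`χ.HasInfinityType p q`: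
`χ((x, 1)) = ∏_w ι_w(x_w)^{-p_w} \overline{ι_w(x_w)}^{-q_w}` near `1`).  Then `p_w = q_w` at every
complex place `w`: the type is PARALLEL, so `χ` is a power of the norm times a character of type
`(0, 0)`, i.e. of finite order (Weil 1956, §1: over a field that is not totally imaginary — a
fortiori over one with a real place — the type `A₀` characters are the `‖·‖^k ψ`, `ψ` of finite
order).

Proof (every ingredient is a proved tree theorem).  Write `n_φ = embExponent p q φ` for the
exponent of the embedding `φ : K → ℂ` (`p_w + q_w` at a real place, `p_w` at `φ = σ_w`, `q_w` at
`φ = σ̄_w` for a complex one).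

* Purity (`HasInfinityType.exists_embExponent_add_conjugate_eq`, Weil; Patrikis 2019, Lemma 2.1.3):
  there is a weight `wt` with `n_φ + n_φ̄ = wt` for all `φ`, and the SAME identity holds for every
  `Aut(ℂ)`-conjugate type `^σ(p, q)`, whose exponents are `n^σ_φ = n_{σ⁻¹ ∘ φ}`
  (`HasInfinityType.embExponent_autConjType_add_conjugate_eq`, `embExponent_autConjType`):
  `n_{σ⁻¹φ} + n_{σ⁻¹φ̄} = wt` for all `σ ∈ Aut(ℂ)` and all `φ`.
* `Aut(ℂ)` is transitive on the embeddings of the countable field `K`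
  (`Literature.FieldTheory.AlgClosed.exists_ringEquiv_apply_eq`): for any `φ` pick `σ` with
  `σ ∘ φ = φ₀ := σ_{w₀}`, the REAL embedding of the real place `w₀` (`φ̄₀ = φ₀`).  The identity at
  `(σ, φ₀)` reads `n_φ + n_φ = wt`, i.e. `2 n_φ = wt` for EVERY embedding `φ`
  (`two_mul_embExponent_eq_of_isReal`).
* At a complex place `w`, `n_{σ_w} = p_w` and `n_{σ̄_w} = q_w`, so `2 p_w = wt = 2 q_w`.

References: A. Weil, *On a certain type of characters of the idèle-class group of an algebraic
number-field*, Proc. Int. Symp. Tokyo–Nikko 1955 (1956), 1–7, §1 [Weil1956].  S. Patrikis,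
*Variations on a theorem of Tate*, Mem. AMS 258 (2019), Lemma 2.1.3 and §2.3 [Patrikis2019].
J.-P. Serre, *Abelian ℓ-adic representations and elliptic curves* (1968), Ch. II §3.3, remark
after the corollary (a field with a real place has only the characters `N^k ψ`) [SerreAbelianLadic1968].
-/

noncomputable section

set_option linter.dupNamespace false -- project-wide option (lakefile weak.linter.dupNamespace); `Summit.Langlands.Langlands` is the mandated namespace

open scoped NumberField Classical
open Filter IsDedekindDomain NumberField
open Literature.NumberTheory.GaloisRepresentations

namespace Summit.Langlands.Langlands.Theorems.ReciprocityUpToIrreducibility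

/-- **`Aut(ℂ)` is transitive on the embeddings of a number field, `ℚ`-algebra form.**  For two
embeddings `φ ψ : K → ℂ` of a number field there is `σ ∈ Aut(ℂ) = (ℂ ≃ₐ[ℚ] ℂ)` with
`σ⁻¹ ∘ ψ = φ` (i.e. `σ ∘ φ = ψ`): `K` is countable and transcendence bases of `ℂ` over `φ(K)` and
over `ψ(K)` are equipotent (`Literature.FieldTheory.AlgClosed.exists_ringEquiv_apply_eq`; Lang,
*Algebra*, Ch. VIII §1, with Ch. V §2 for the extension to the algebraic closure).
[cite: Lang2002, Ch. VIII §1 Thm. 1.1 and Ch. V §2 Thm. 2.8] -/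
theorem exists_algEquiv_symm_comp_eq {K : Type} [Field K] [NumberField K] (φ ψ : K →+* ℂ) :
    ∃ σ : ℂ ≃ₐ[ℚ] ℂ, (σ.symm : ℂ ≃ₐ[ℚ] ℂ).toAlgHom.toRingHom.comp ψ = φ := by
  haveI : Countable K := Countable.of_equiv _ (Module.finBasis ℚ K).equivFun.toEquiv.symm
  have hK : Cardinal.mk K ≤ Cardinal.aleph0 := Cardinal.mk_le_aleph0
  have hC : Cardinal.aleph0 < Cardinal.mk ℂ := by
    rw [Cardinal.mk_complex]; exact Cardinal.aleph0_lt_continuum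
  obtain ⟨τ, hτ⟩ := Literature.FieldTheory.AlgClosed.exists_ringEquiv_apply_eq hC hK φ ψ
  let σ : ℂ ≃ₐ[ℚ] ℂ := AlgEquiv.ofRingEquiv (f := τ) fun x ↦ by simp
  refine ⟨σ, RingHom.ext fun x ↦ ?_⟩
  change σ.symm (ψ x) = φ x
  rw [AlgEquiv.symm_apply_eq]
  exact (hτ x).symm

/-- **Twice every exponent is the weight, over a field with a real embedding.**  If the exponents
`n_φ = embExponent p q φ` of a type `(p, q)` satisfy the weight identity `n^σ_φ + n^σ_φ̄ = wt` for
every conjugate type `^σ(p, q)` (`n^σ_φ = n_{σ⁻¹∘φ}`, `HeckeCharacter.embExponent_autConjType`) and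
`K` has a real embedding `φ₀` (`φ̄₀ = φ₀`), then `2 n_φ = wt` for every embedding `φ`: choose `σ`
with `σ⁻¹ ∘ φ₀ = φ` (`exists_algEquiv_symm_comp_eq`) and read the identity at `(σ, φ₀)`.
Weil 1956, §1: the type of a character of type `A₀` of a field that is not totally imaginary is a
multiple of `∑_φ φ`. [cite: Weil1956, §1] -/
theorem two_mul_embExponent_eq_of_isReal {K : Type} [Field K] [NumberField K]
    {p q : InfinitePlace K → ℤ} {wt : ℤ}
    (hw : ∀ (σ : ℂ ≃ₐ[ℚ] ℂ) (φ : K →+* ℂ),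
      HeckeCharacter.embExponent (HeckeCharacter.autConjType σ p q).1
          (HeckeCharacter.autConjType σ p q).2 φ +
        HeckeCharacter.embExponent (HeckeCharacter.autConjType σ p q).1
          (HeckeCharacter.autConjType σ p q).2 (ComplexEmbedding.conjugate φ) = wt)
    {φ₀ : K →+* ℂ} (hφ₀ : ComplexEmbedding.IsReal φ₀) (φ : K →+* ℂ) :
    2 * HeckeCharacter.embExponent p q φ = wt := by
  obtain ⟨σ, hσ⟩ := exists_algEquiv_symm_comp_eq φ φ₀
  have h := hw σ φ₀
  rw [ComplexEmbedding.isReal_iff.mp hφ₀, HeckeCharacter.embExponent_autConjType, hσ] at h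
  omega

/-- **stub N11-G (Weil 1956, §1): over a number field with a real place every algebraic Hecke
character has parallel infinity type.**  If `K` has a real place and `χ` has infinity type
`(p, q)`, then `p_w = q_w` at every complex place `w`: by purity
(`HasInfinityType.exists_embExponent_add_conjugate_eq`,
`HasInfinityType.embExponent_autConjType_add_conjugate_eq`) and a real embedding, twice every
exponent is the weight (`two_mul_embExponent_eq_of_isReal`), and the exponents of `σ_w`, `σ̄_w` at a
complex place are `p_w`, `q_w`.  Hence `χ ‖·‖^{p}` has type `(0, 0)` for the common value and `χ` is
`‖·‖^{-k}` times a character of finite order (Serre 1968, Ch. II §3.3, remark; Weil 1956, §1).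
[cite: Weil1956, §1] -/
theorem stub_infinityType_parallel_of_isReal :
    ∀ (K : Type) [Field K] [NumberField K], (∃ w₀ : NumberField.InfinitePlace K, w₀.IsReal) →
      ∀ (χ : HeckeCharacter K) (p q : NumberField.InfinitePlace K → ℤ), χ.HasInfinityType p q →
      ∀ w : NumberField.InfinitePlace K, w.IsComplex → p w = q w := by
  intro K _ _ hK χ p q h w hw
  obtain ⟨w₀, hw₀⟩ := hK
  obtain ⟨wt, hwt⟩ := h.exists_embExponent_add_conjugate_eq
  have hφ₀ : ComplexEmbedding.IsReal w₀.embedding := NumberField.InfinitePlace.isReal_iff.mp hw₀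
  have key : ∀ φ : K →+* ℂ, 2 * HeckeCharacter.embExponent p q φ = wt :=
    two_mul_embExponent_eq_of_isReal
      (fun σ φ ↦ h.embExponent_autConjType_add_conjugate_eq σ hwt φ) hφ₀
  -- the exponents of `σ_w` and `σ̄_w` at the complex place `w` are `p_w` and `q_w`
  have hnr : ¬ ComplexEmbedding.IsReal w.embedding :=
    NumberField.InfinitePlace.isComplex_iff.mp hw
  have hnr' : ¬ ComplexEmbedding.IsReal (ComplexEmbedding.conjugate w.embedding) := by
    rwa [ComplexEmbedding.isReal_conjugate_iff]
  have hne : ComplexEmbedding.conjugate w.embedding ≠ w.embedding := fun h' ↦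
    hnr (ComplexEmbedding.isReal_iff.mpr h')
  have hp := key w.embedding
  have hq := key (ComplexEmbedding.conjugate w.embedding)
  unfold HeckeCharacter.embExponent at hp hq
  rw [NumberField.InfinitePlace.mk_embedding, if_neg hnr, if_pos rfl] at hp
  rw [NumberField.InfinitePlace.mk_conjugate_eq, NumberField.InfinitePlace.mk_embedding, if_neg hnr',
    if_neg hne] at hq
  omega

end Summit.Langlands.Langlands.Theorems.ReciprocityUpToIrreducibility

end
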